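import Literature.AlgebraicGeometry.Motives.ShearCocycleUnitAtGenericFibre
import Literature.RingTheory.Derivation.ResidueJacobianOne
import Literature.AlgebraicGeometry.Motives.GenericFibreUnitSlice
import HarnessLib

/-!
# The shear cocycle has a germ of residue `1` at a point of a slice fixed by the shear

Road W of the cell hodgecm-mathlib's r₀ programme — the (W0) core (B-p18's `W0-CORE-SPEC` §4), leaf L4c′
«the shear identity in `K(Y)`», its SECOND input (`hpin` of B-p12's closer
★ `Motives.shear_identity_of_residue_eq_one`): in the setting of ★ `isUnitAt_shearCocycle_of_mem_genericFibre`
(model `𝒳 → Spec R`, `Y := 𝒳 ×_R 𝒳`, open `D ⊇ U₀`, shear `Φ = ΦD : D → Y` over `pr₁` with action `σ` on `K(Y)`,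
top form `θ = (f₀, y)` on `𝒳` which is a frame on the generic fibre, relative basis `B₂`), suppose given a
**slice fixed by the shear**: a scheme `T`, a point `w ∈ T` and a morphism `iT : T → D` such that
`iT ≫ ι ≫ pr₂ =: J` induces an isomorphism of local rings at `w` (a section of `pr₂` up to an open
immersion), `iT ≫ ι ≫ pr₁ = πT ≫ x` is constant equal to a `K`-point `x` of the generic fibre, and
`iT ≫ Φ = iT ≫ ι` (in the cell: `T = 𝒳_K`, `iT = (x, id)`, and `Φ ∘ iT = iT` is the unit law `m(x, x') = x'` of
the birational group law at the unit point `x = ε`).  Then at the point `z := ι (iT w)` the cocycle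
`c = σ(pr₂♯ f₀) · B₂.det (d σ(pr₂♯ yᵢ))ᵢ · (pr₂♯ f₀)⁻¹ ∈ K(Y)` has a germ `t ∈ 𝒪_{Y,z}` with `residue t = 1`.

Proof ([BLRNeronModels1990] §4.3 proof of Prop. 6 / [EdixhovenRomagny2012] proof of Thm. 6.3, the `ω`-argument at
the origin): the germ is the one of ★ `exists_germs_cocycle_eq` at `q := iT w` for the pair `(Φ, ι)` and the
product-chart coordinates `pr₂♯ ζᵢ` at `z` and at `Φ q = z` (★ `exists_basis_stalk_tensorObj_eq_D`), read back on
`Y` through the isomorphism `ι♯_q`; its three factors are `μ(u₀)`, `det (d μ ζᵢ)` in the basis `d (p ζᵢ)`, and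
`p(u₀)⁻¹` for the two ring maps `p := (ι ≫ pr₂)♯_q`, `μ := (Φ ≫ pr₂)♯_q : 𝒪_{𝒳,x₀} → 𝒪_{D,q}` (`x₀ = pr₂ z`) and the
unit germ `u₀` of the frame coefficient of `θ` at `x₀`; the slice gives a common retraction `s := (J♯_w)⁻¹ ∘ iT♯_w`
of `p` and `μ`, under which the `pr₁`-scalars `Γ(𝒳, V₁)` become constants from `K = Frac R` (killed by `d`), so
★ `Literature.RingTheory.Derivation.residue_det_eq_one_of_section` («the relative Jacobian is `≡ 1 mod 𝔪`») and
★ `residue_map_section_eq` (`residue (μ u₀) = residue (p u₀)`) give `residue = 1`.  THEOREMS ONLY; the group law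
does not enter the core theorem (only `hfix`).  The last theorem `exists_germ_shearCocycle_residue_eq_one_unitPoint`
is the `hpin` input VERBATIM (germ at the `K`-point `(ε, ε)`), obtained on the unit slice `b ↦ (ε, b)` of the generic
fibre (★ `exists_unitSlice_liftD`, where the group law `m(ε, b) = b` enters).
[cite: BLRNeronModels1990, §4.3 (Prop. 6, proof)] [cite: EdixhovenRomagny2012, Thm. 6.3 (proof)]

## Sources
* S. Bosch, W. Lütkebohmert, M. Raynaud, *Néron Models*, Springer 1990, §4.3 (proof of Prop. 6), §2.2 Prop. 11.
* B. Edixhoven, M. Romagny, *Group schemes out of birational group laws, Néron models*, arXiv:1204.1799, Thm. 6.3.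
* Tree: `Motives/ShearCocycleUnitAtGenericFibre.lean`, `Motives/TopFormCocycleUnitAtPair.lean`,
  `RingTheory/Derivation/ResidueJacobianOne.lean`, `Motives/ProductChartStalks.lean`.
-/

noncomputable section

universe u

open CategoryTheory Limits AlgebraicGeometry Opposite MonoidalCategory CartesianMonoidalCategory

namespace Literature.AlgebraicGeometry.Motives

open RatFn Literature.RingTheory.Derivation Literature.AlgebraicGeometry.Smoothening
open Literature.NumberTheory.EllipticCurves IsLocalRing

/-! ### Two ring-level helpers (private) -/

/-- `A`-linear differentials kill the fraction field of the ground ring: if `ψ : K → O` is a ring map into an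
`A`-algebra with `ψ ∘ (R → K) = (A → O) ∘ (R → A)` and `K = Frac R`, then `d_A (ψ k) = 0` for all `k`
(`k = r / r'`, Leibniz). [folklore] -/
private theorem kaehlerDifferential_D_eq_zero_of_isFractionRing {R K A O : Type*} [CommRing R] [Nontrivial R]
    [Field K] [Algebra R K] [IsFractionRing R K] [CommRing A] [CommRing O] [Algebra R A] [Algebra A O]
    (ψ : K →+* O) (hψ : ∀ r, ψ (algebraMap R K r) = algebraMap A O (algebraMap R A r)) (k : K) :
    KaehlerDifferential.D A O (ψ k) = 0 := by
  obtain ⟨a, b, hb, rfl⟩ := IsFractionRing.div_surjective (A := R) k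
  have hb' : algebraMap R K b ≠ 0 := IsFractionRing.to_map_ne_zero_of_mem_nonZeroDivisors hb
  have hmul : ψ (algebraMap R K a / algebraMap R K b) * ψ (algebraMap R K b) = ψ (algebraMap R K a) := by
    rw [← map_mul, div_mul_cancel₀ _ hb']
  have hd := congrArg (KaehlerDifferential.D A O) hmul
  rw [Derivation.leibniz, hψ a, hψ b, Derivation.map_algebraMap, Derivation.map_algebraMap, smul_zero,
    zero_add] at hd
  have hu : IsUnit (algebraMap A O (algebraMap R A b)) := by
    rw [← hψ b]; exact (IsUnit.mk0 _ hb').map ψ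
  obtain ⟨v, hv⟩ := hu
  rw [← hv] at hd
  have h2 := congrArg (fun m => ((v⁻¹ : Oˣ) : O) • m) hd
  simpa only [smul_zero, ← mul_smul, Units.inv_mul, one_smul] using h2

/-- Every germ at a point of `Spec K`, `K` a field, is the germ of a global section: the map
`K = Γ(Spec K) → 𝒪_{Spec K, p}` is surjective (the only open neighbourhood is `⊤`). [folklore] -/
private theorem exists_germ_ΓSpecIso_inv_eq {K : Type u} [Field K] (p : ↥(Spec (.of K)))
    (f : (Spec (.of K)).presheaf.stalk p) :
    ∃ k : K, (Spec (.of K)).presheaf.germ ⊤ p trivial ((Scheme.ΓSpecIso (.of K)).inv k) = f := by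
  obtain ⟨U, hpU, g, rfl⟩ := TopCat.Presheaf.exists_germ_eq (Spec (.of K)).presheaf f
  have hU : U = ⊤ := by
    refine le_antisymm le_top fun q _ => ?_
    rw [Subsingleton.elim q p]
    exact hpU
  subst hU
  exact ⟨(Scheme.ΓSpecIso (.of K)).hom g,
    congrArg ((Spec (.of K)).presheaf.germ ⊤ p trivial) (Iso.hom_inv_id_apply (Scheme.ΓSpecIso (.of K)) g)⟩

/-- Stalk maps of a morphism of `R`-schemes commute with the structure maps `stalkHom` — ★ `stalkMap_comp_stalkHom`
for a scheme morphism `f : 𝒴.left → 𝒳.left` given with the compatibility `f ≫ 𝒳.hom = 𝒴.hom`, elementwise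
(Görtz–Wedhorn I, (3.4)–(3.5)). [cite: GortzWedhorn2020, (3.4)–(3.5)] -/
theorem stalkMap_stalkHom_of_comp_eq {R : Type u} [CommRing R] {𝒳 𝒴 : Over (Spec (.of R))}
    (f : 𝒴.left ⟶ 𝒳.left) (hf : f ≫ 𝒳.hom = 𝒴.hom) (y : 𝒴.left) (r : R) :
    f.stalkMap y (stalkHom 𝒳 (f.base y) r) = stalkHom 𝒴 y r := by
  simp only [stalkHom, globalHom, RingHom.coe_comp, Function.comp_apply]
  rw [Scheme.Hom.germ_stalkMap_apply]
  have happ : (f.app ⊤) (𝒳.hom.appTop ((Scheme.ΓSpecIso (.of R)).inv r)) =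
      𝒴.hom.appTop ((Scheme.ΓSpecIso (.of R)).inv r) := by
    rw [← hf, Scheme.Hom.comp_appTop]
    rfl
  rw [happ]
  rfl

/-- **A slice fixed by `Φ` retracts both `(ι ≫ pr)♯` and `(Φ ≫ pr)♯.**  For `iT : T → D'`, `ι Φ : D' → Y`,
`pr : Y → X` with `iT ≫ Φ = iT ≫ ι` and `J := iT ≫ ι ≫ pr` inducing an isomorphism of local rings at `w`, the map
`s := (J♯_w)⁻¹ ∘ iT♯_w : 𝒪_{D', iT w} → 𝒪_{X, pr (ι (iT w))}` satisfies `s ∘ (ι ≫ pr)♯ = id` and `s ∘ (Φ ≫ pr)♯ = id`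
(the latter read through the specialisation `pr (Φ (iT w)) ⤳ pr (ι (iT w))` of the two equal points).  This is the
ring-level shape of «`Φ` restricted to the slice `{ε} × X` is the identity» in the `ω`-argument.
[cite: EdixhovenRomagny2012, Thm. 6.3 (proof)] -/
theorem slice_section_retracts {T D' Y X : Scheme.{u}} (iT : T ⟶ D') (ι Φ : D' ⟶ Y) (pr : Y ⟶ X) (w : T)
    (hfix : iT ≫ Φ = iT ≫ ι) [IsIso ((iT ≫ ι ≫ pr).stalkMap w)]
    (h : pr.base (Φ.base (iT.base w)) ⤳ pr.base (ι.base (iT.base w))) :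
    (∀ g : X.presheaf.stalk (pr.base (ι.base (iT.base w))),
        (inv ((iT ≫ ι ≫ pr).stalkMap w)) (iT.stalkMap w (((ι ≫ pr).stalkMap (iT.base w)) g)) = g) ∧
    (∀ g : X.presheaf.stalk (pr.base (ι.base (iT.base w))),
        (inv ((iT ≫ ι ≫ pr).stalkMap w)) (iT.stalkMap w (((Φ ≫ pr).stalkMap (iT.base w))
          (X.presheaf.stalkSpecializes h g))) = g) := by
  -- the inverse of `J♯_w`, typed at the point `pr (ι (iT w))`
  let invJ : T.presheaf.stalk w →+* X.presheaf.stalk (pr.base (ι.base (iT.base w))) :=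
    (inv ((iT ≫ ι ≫ pr).stalkMap w)).hom
  have hinvJ : ∀ v, invJ (((iT ≫ ι ≫ pr).stalkMap w) v) = v := fun v => by
    have e := congrArg (fun φ => φ.hom v) (IsIso.hom_inv_id ((iT ≫ ι ≫ pr).stalkMap w))
    simp only [CommRingCat.hom_comp, CommRingCat.hom_id, RingHom.coe_comp, Function.comp_apply,
      RingHom.id_apply] at e
    exact e
  -- `(ι ≫ pr)♯ ≫ iT♯ = J♯`
  have hpJ : (ι ≫ pr).stalkMap (iT.base w) ≫ iT.stalkMap w = (iT ≫ ι ≫ pr).stalkMap w :=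
    (Scheme.Hom.stalkMap_comp iT (ι ≫ pr) w).symm
  -- `spec ≫ (Φ ≫ pr)♯ ≫ iT♯ = J♯` by `hfix`
  have hfix' : iT ≫ Φ ≫ pr = iT ≫ ι ≫ pr := by rw [← Category.assoc, hfix, Category.assoc]
  have a1 : (Φ ≫ pr).stalkMap (iT.base w) ≫ iT.stalkMap w = (iT ≫ Φ ≫ pr).stalkMap w :=
    (Scheme.Hom.stalkMap_comp iT (Φ ≫ pr) w).symm
  have a2 := Scheme.Hom.stalkMap_congr_hom _ _ hfix' w
  have a3 : X.presheaf.stalkSpecializes h ≫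
      X.presheaf.stalkSpecializes
        ((Inseparable.of_eq (by rw [hfix']) :
          Inseparable ((iT ≫ Φ ≫ pr).base w) ((iT ≫ ι ≫ pr).base w)).ge) =
      𝟙 (X.presheaf.stalk (pr.base (ι.base (iT.base w)))) := by
    erw [TopCat.Presheaf.stalkSpecializes_comp]
    exact TopCat.Presheaf.stalkSpecializes_refl _ _
  refine ⟨fun g => ?_, fun g => ?_⟩
  · have e := congrArg (fun φ => invJ (φ.hom g)) hpJ
    simp only [CommRingCat.hom_comp, RingHom.coe_comp, Function.comp_apply] at e
    exact e.trans (hinvJ g)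
  · have e1 := congrArg (fun φ => φ.hom (X.presheaf.stalkSpecializes h g)) a1
    have e2 := congrArg (fun φ => φ.hom (X.presheaf.stalkSpecializes h g)) a2
    have e3 := congrArg (fun φ => ((iT ≫ ι ≫ pr).stalkMap w).hom (φ.hom g)) a3
    simp only [CommRingCat.hom_comp, RingHom.coe_comp, Function.comp_apply,
      TopCat.Presheaf.stalkCongr_hom] at e1 e2 e3
    exact (congrArg invJ ((e1.trans e2).trans e3)).trans (hinvJ g)

variable {R : Type u} [CommRing R] [IsDomain R] (K : Type u) [Field K] [Algebra R K] [IsFractionRing R K]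
  [IsOpenImmersion (specGenericPoint R K)]
  (𝒳 : Over (Spec (.of R))) [IsIntegral 𝒳.left] [IsIntegral (𝒳 ⊗ 𝒳).left]
  [IsDominant (fst 𝒳 𝒳).left] [IsDominant (snd 𝒳 𝒳).left] (n : ℕ) [SmoothOfRelativeDimension n 𝒳.hom]
  [Algebra R 𝒳.left.functionField] [Algebra 𝒳.left.functionField (𝒳 ⊗ 𝒳).left.functionField]

omit [IsDomain R] [IsFractionRing R K] [IsOpenImmersion (specGenericPoint R K)] [IsDominant (fst 𝒳 𝒳).left]
  [SmoothOfRelativeDimension n 𝒳.hom] [Algebra 𝒳.left.functionField (𝒳 ⊗ 𝒳).left.functionField] in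
/-- **The frame of `pr₂^*θ` at a point of `Y = 𝒳 ×_R 𝒳` over the generic point, as a pull-back from `𝒳`.**
If `θ = (f₀, y)` is a frame at every point of the generic fibre of `𝒳` (`hθ`), then at a point `Q₀` of `Y` over the
generic point, for product-chart coordinates `wQ = pr₂♯ (y_V)` at `Q₀` (relative to the scalars `A`, with
function-field basis `WQ = d_A (pr₂♯ y_V)`), the frame coefficient `pr₂♯ f₀ · WQ.det B` (`B = d_A (pr₂♯ yᵢ)`) is the
pull-back `pr₂♯ g₀` of a rational function `g₀` on `𝒳` which is a UNIT at `pr₂ Q₀` — namely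
`g₀ = f₀ · (d ζ).det (d y)` for the germs `ζ` of the chart coordinates at `pr₂ Q₀` (chain rule ★ `det_D_ringHom_eq`
along `pr₂♯`). [cite: BLRNeronModels1990, §4.3 (Prop. 6, proof) and §2.2 Prop. 11] -/
theorem exists_frame_functionFieldMap_snd
    (hRK : algebraMap R 𝒳.left.functionField = stalkHom 𝒳 (genericPoint 𝒳.left))
    (f₀ : 𝒳.left.functionField) (y : Fin n → 𝒳.left.functionField)
    (B₀ : Module.Basis (Fin n) 𝒳.left.functionField Ω[𝒳.left.functionField⁄R])
    (hB₀ : ∀ i, B₀ i = KaehlerDifferential.D R _ (y i))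
    (hθ : ∀ (p : 𝒳.left) (_ : 𝒳.hom.base p ∈ Set.range (specGenericPoint R K).base)
        (z : Fin n → 𝒳.left.presheaf.stalk p)
        (b : letI := (stalkHom 𝒳 p).toAlgebra
          Module.Basis (Fin n) (𝒳.left.presheaf.stalk p) Ω[𝒳.left.presheaf.stalk p⁄R])
        (_ : letI := (stalkHom 𝒳 p).toAlgebra; ∀ i, b i = KaehlerDifferential.D R _ (z i))
        (B : Module.Basis (Fin n) 𝒳.left.functionField Ω[𝒳.left.functionField⁄R])
        (_ : ∀ i, B i = KaehlerDifferential.D R _ (toFunctionField p (z i))),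
        IsUnitAt p (f₀ * B.det B₀))
    {A : Type u} [CommRing A] [Algebra R A] [Algebra A (𝒳 ⊗ 𝒳).left.functionField]
    (hστ : (functionFieldMap (snd 𝒳 𝒳).left).comp (algebraMap R 𝒳.left.functionField) =
      (algebraMap A (𝒳 ⊗ 𝒳).left.functionField).comp (algebraMap R A))
    (B : Module.Basis (Fin n) (𝒳 ⊗ 𝒳).left.functionField Ω[(𝒳 ⊗ 𝒳).left.functionField⁄A])
    (hB : ∀ i, B i = KaehlerDifferential.D A _ (functionFieldMap (snd 𝒳 𝒳).left (y i)))
    {Q₀ : ↥(𝒳 ⊗ 𝒳).left} (hQ₀ : (𝒳 ⊗ 𝒳).hom.base Q₀ ∈ Set.range (specGenericPoint R K).base)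
    {V : 𝒳.left.Opens} (hV : IsAffineOpen V) (hQ₀V : (snd 𝒳 𝒳).left.base Q₀ ∈ V)
    [Algebra R Γ(𝒳.left, V)]
    (halgV : algebraMap R Γ(𝒳.left, V) = ((Scheme.ΓSpecIso (.of R)).inv ≫ 𝒳.hom.appLE ⊤ V le_top).hom)
    {yV : Fin n → Γ(𝒳.left, V)} (bV : Module.Basis (Fin n) Γ(𝒳.left, V) Ω[Γ(𝒳.left, V)⁄R])
    (hbV : ∀ i, bV i = KaehlerDifferential.D R _ (yV i)) [Nonempty V]
    [Algebra A ((𝒳 ⊗ 𝒳).left.presheaf.stalk Q₀)]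
    [IsScalarTower A ((𝒳 ⊗ 𝒳).left.presheaf.stalk Q₀) (𝒳 ⊗ 𝒳).left.functionField]
    {wQ : Fin n → (𝒳 ⊗ 𝒳).left.presheaf.stalk Q₀}
    (hwQ : ∀ i, toFunctionField Q₀ (wQ i) =
      functionFieldMap (snd 𝒳 𝒳).left (algebraMap Γ(𝒳.left, V) 𝒳.left.functionField (yV i)))
    (WQ : Module.Basis (Fin n) (𝒳 ⊗ 𝒳).left.functionField Ω[(𝒳 ⊗ 𝒳).left.functionField⁄A])
    (hWQ : ∀ i, WQ i = KaehlerDifferential.D A _ (toFunctionField Q₀ (wQ i))) :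
    ∃ g₀ : 𝒳.left.functionField, IsUnitAt ((snd 𝒳 𝒳).left.base Q₀) g₀ ∧
      functionFieldMap (snd 𝒳 𝒳).left g₀ = functionFieldMap (snd 𝒳 𝒳).left f₀ * WQ.det B := by
  classical
  have hY₂ : (snd 𝒳 𝒳).left ≫ 𝒳.hom = (𝒳 ⊗ 𝒳).hom := Over.w _
  have hBfun : (fun j => KaehlerDifferential.D A (𝒳 ⊗ 𝒳).left.functionField
      (functionFieldMap (snd 𝒳 𝒳).left (y j))) = ⇑B := funext fun j => (hB j).symm
  have hB₀fun : (fun j => KaehlerDifferential.D R 𝒳.left.functionField (y j)) = ⇑B₀ :=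
    funext fun j => (hB₀ j).symm
  -- the point `p := pr₂ Q₀` of `𝒳`, over the generic point
  have hpgen : 𝒳.hom.base ((snd 𝒳 𝒳).left.base Q₀) ∈ Set.range (specGenericPoint R K).base := by
    have h := congrArg (fun φ => φ.base Q₀) hY₂
    simp only [Scheme.Hom.comp_base, TopCat.comp_app] at h
    rw [h]; exact hQ₀
  -- the local ring at `p` as an `R`- and a `Γ(V)`-algebra (germs), a localisation of `Γ(V)`
  letI algVp : Algebra Γ(𝒳.left, V) (𝒳.left.presheaf.stalk ((snd 𝒳 𝒳).left.base Q₀)) :=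
    TopCat.Presheaf.algebra_section_stalk 𝒳.left.presheaf (⟨_, hQ₀V⟩ : V)
  letI algRp : Algebra R (𝒳.left.presheaf.stalk ((snd 𝒳 𝒳).left.base Q₀)) :=
    (stalkHom 𝒳 ((snd 𝒳 𝒳).left.base Q₀)).toAlgebra
  haveI towRVp : IsScalarTower R Γ(𝒳.left, V) (𝒳.left.presheaf.stalk ((snd 𝒳 𝒳).left.base Q₀)) := by
    refine IsScalarTower.of_algebraMap_eq fun r => ?_
    rw [halgV]
    change stalkHom 𝒳 _ r = 𝒳.left.presheaf.germ V _ hQ₀V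
      (((Scheme.ΓSpecIso (.of R)).inv ≫ 𝒳.hom.appLE ⊤ V le_top) r)
    simp only [Scheme.Hom.appLE, CommRingCat.hom_comp, stalkHom, globalHom, RingHom.coe_comp,
      Function.comp_apply]
    rw [TopCat.Presheaf.germ_res_apply 𝒳.left.presheaf]
    rfl
  haveI : IsLocalization.AtPrime (𝒳.left.presheaf.stalk ((snd 𝒳 𝒳).left.base Q₀))
      (hV.primeIdealOf (⟨_, hQ₀V⟩ : V)).asIdeal := hV.isLocalization_stalk ⟨_, hQ₀V⟩
  -- local coordinates at `p` over `R`: the germs of the chart coordinates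
  obtain ⟨bz, hbz⟩ := exists_basis_kaehler_localization_eq_D
    (𝒳.left.presheaf.stalk ((snd 𝒳 𝒳).left.base Q₀))
    (hV.primeIdealOf (⟨_, hQ₀V⟩ : V)).asIdeal.primeCompl bV hbV
  -- the scalar tower `R → 𝒪_p → K(𝒳)`
  haveI towRpK : IsScalarTower R (𝒳.left.presheaf.stalk ((snd 𝒳 𝒳).left.base Q₀))
      𝒳.left.functionField := by
    refine IsScalarTower.of_algebraMap_eq fun r => ?_
    rw [hRK]
    change _ = toFunctionField _ (stalkHom 𝒳 _ r)
    simp only [stalkHom, globalHom, RingHom.coe_comp, Function.comp_apply]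
    rw [toFunctionField_germ]
  obtain ⟨Bp, hBp⟩ := exists_basis_functionField_of_localCoordinates' n R bz hbz
  -- `θ` is a frame at `p`
  have hθp := hθ ((snd 𝒳 𝒳).left.base Q₀) hpgen _ bz hbz Bp hBp
  -- rewrite the determinant by the chain rule along `pr₂♯`
  have hWQ' : ∀ i, WQ i = KaehlerDifferential.D A _
      (functionFieldMap (snd 𝒳 𝒳).left (toFunctionField ((snd 𝒳 𝒳).left.base Q₀)
        (algebraMap Γ(𝒳.left, V) _ (yV i)))) := fun i => by
    have e := toFunctionField_algebraMap_stalk (V := V) (⟨_, hQ₀V⟩ : V) (yV i)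
    rw [hWQ, hwQ, ← e]
  have hchain := det_D_ringHom_eq (algebraMap R A) (functionFieldMap (snd 𝒳 𝒳).left)
    hστ Bp hBp WQ hWQ' y
  rw [hB₀fun, hBfun] at hchain
  exact ⟨f₀ * Bp.det B₀, hθp, by rw [map_mul, hchain]⟩

omit [IsDomain R] [IsFractionRing R K] [IsOpenImmersion (specGenericPoint R K)] [IsIntegral 𝒳.left]
  [IsIntegral (𝒳 ⊗ 𝒳).left] [IsDominant (fst 𝒳 𝒳).left] [IsDominant (snd 𝒳 𝒳).left]
  [Algebra R 𝒳.left.functionField] [Algebra 𝒳.left.functionField (𝒳 ⊗ 𝒳).left.functionField] in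
/-- **The `pr₁`-scalars are constant along the slice.**  For the slice `iT : T → D` through the `K`-point `x`
(`iT ≫ ι ≫ pr₁ = πT ≫ x`, `J := iT ≫ ι ≫ pr₂` an isomorphism on local rings at `w`) and `r ∈ R`: transporting the
constant `r ∈ K = Γ(Spec K)` along `Spec K ← T → 𝒳` and then `pr₂♯` to `𝒪_{D, iT w}` gives the same element as
`r ∈ Γ(𝒳, V₁)` read through `pr₁♯` — both are the structure map `R → 𝒪_{D, iT w}` (★ `stalkMap_comp_stalkHom`).
[cite: GortzWedhorn2020, (3.4)–(3.5)] -/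
theorem slice_scalar_eq (D : (𝒳 ⊗ 𝒳).left.Opens)
    {T : Scheme.{u}} (w : T) (iT : T ⟶ (D : Scheme.{u})) [IsIso ((iT ≫ D.ι ≫ (snd 𝒳 𝒳).left).stalkMap w)]
    (πT : T ⟶ Spec (.of K)) (x : Spec (.of K) ⟶ 𝒳.left) (hx : x ≫ 𝒳.hom = specGenericPoint R K)
    (hconst : iT ≫ D.ι ≫ (fst 𝒳 𝒳).left = πT ≫ x)
    (V₁ : 𝒳.left.Opens) (h₁V : (fst 𝒳 𝒳).left.base (D.ι.base (iT.base w)) ∈ V₁) (r : R) :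
    ((D.ι ≫ (snd 𝒳 𝒳).left).stalkMap (iT.base w))
      ((inv ((iT ≫ D.ι ≫ (snd 𝒳 𝒳).left).stalkMap w)) (πT.stalkMap w
        ((Spec (.of K)).presheaf.germ ⊤ (πT.base w) trivial ((Scheme.ΓSpecIso (.of K)).inv (algebraMap R K r))))) =
    D.ι.stalkMap (iT.base w) ((fst 𝒳 𝒳).left.stalkMap (D.ι.base (iT.base w))
      (𝒳.left.presheaf.germ V₁ _ h₁V (((Scheme.ΓSpecIso (.of R)).inv ≫ 𝒳.hom.appLE ⊤ V₁ le_top) r))) := by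
  have hY₁ : (fst 𝒳 𝒳).left ≫ 𝒳.hom = (𝒳 ⊗ 𝒳).hom := Over.w _
  have hY₂ : (snd 𝒳 𝒳).left ≫ 𝒳.hom = (𝒳 ⊗ 𝒳).hom := Over.w _
  have hJR : (iT ≫ D.ι ≫ (snd 𝒳 𝒳).left) ≫ 𝒳.hom = πT ≫ specGenericPoint R K := by
    rw [Category.assoc, Category.assoc, hY₂, ← hY₁, ← Category.assoc D.ι, ← Category.assoc iT,
      hconst, Category.assoc, hx]
  -- typed bridges at the point `x₀ := pr₂ (ι (iT w))`
  let p : 𝒳.left.presheaf.stalk ((snd 𝒳 𝒳).left.base (D.ι.base (iT.base w))) →+*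
      (D : Scheme.{u}).presheaf.stalk (iT.base w) :=
    ((D.ι ≫ (snd 𝒳 𝒳).left).stalkMap (iT.base w)).hom
  let invJ : T.presheaf.stalk w →+* 𝒳.left.presheaf.stalk ((snd 𝒳 𝒳).left.base (D.ι.base (iT.base w))) :=
    (inv ((iT ≫ D.ι ≫ (snd 𝒳 𝒳).left).stalkMap w)).hom
  have hinvJ : ∀ v, invJ (((iT ≫ D.ι ≫ (snd 𝒳 𝒳).left).stalkMap w) v) = v := fun v => by
    have e := congrArg (fun φ => φ.hom v) (IsIso.hom_inv_id ((iT ≫ D.ι ≫ (snd 𝒳 𝒳).left).stalkMap w))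
    simp only [CommRingCat.hom_comp, CommRingCat.hom_id, RingHom.coe_comp, Function.comp_apply,
      RingHom.id_apply] at e
    exact e
  -- left: `R → K → 𝒪_{Spec K}` is `stalkHom`; then `stalkHom` of `T`, of `𝒳`, of `D`
  have l1 : (Spec (.of K)).presheaf.germ ⊤ (πT.base w) trivial ((Scheme.ΓSpecIso (.of K)).inv
      (algebraMap R K r)) =
      stalkHom (Over.mk (specGenericPoint R K) : Over (Spec (.of R))) (πT.base w) r := by
    change _ = (Spec (.of K)).presheaf.germ ⊤ (πT.base w) trivial
      (((Scheme.ΓSpecIso (.of R)).inv ≫ (Spec.map (CommRingCat.ofHom (algebraMap R K))).appTop) r)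
    rw [← Scheme.ΓSpecIso_inv_naturality]
    rfl
  have l2 : πT.stalkMap w ((Spec (.of K)).presheaf.germ ⊤ (πT.base w) trivial
      ((Scheme.ΓSpecIso (.of K)).inv (algebraMap R K r))) =
      stalkHom (Over.mk (πT ≫ specGenericPoint R K) : Over (Spec (.of R))) w r :=
    (congrArg (πT.stalkMap w) l1).trans
      (stalkMap_stalkHom_of_comp_eq (𝒳 := Over.mk (specGenericPoint R K))
        (𝒴 := Over.mk (πT ≫ specGenericPoint R K)) πT rfl w r)
  have l3 : invJ (stalkHom (Over.mk (πT ≫ specGenericPoint R K) : Over (Spec (.of R))) w r) =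
      stalkHom 𝒳 ((snd 𝒳 𝒳).left.base (D.ι.base (iT.base w))) r :=
    (congrArg invJ (stalkMap_stalkHom_of_comp_eq (𝒳 := 𝒳) (𝒴 := Over.mk (πT ≫ specGenericPoint R K))
      (iT ≫ D.ι ≫ (snd 𝒳 𝒳).left) hJR w r).symm).trans (hinvJ _)
  have l4 : p (stalkHom 𝒳 ((snd 𝒳 𝒳).left.base (D.ι.base (iT.base w))) r) =
      stalkHom (Over.mk (D.ι ≫ (𝒳 ⊗ 𝒳).hom) : Over (Spec (.of R))) (iT.base w) r :=
    stalkMap_stalkHom_of_comp_eq (𝒳 := 𝒳) (𝒴 := Over.mk (D.ι ≫ (𝒳 ⊗ 𝒳).hom))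
      (D.ι ≫ (snd 𝒳 𝒳).left) (by rw [Category.assoc, hY₂]; rfl) (iT.base w) r
  -- right: `R → Γ(V₁) → 𝒪_{𝒳, pr₁ z} → 𝒪_{Y, z} → 𝒪_{D, q}`
  have r1 : 𝒳.left.presheaf.germ V₁ _ h₁V (((Scheme.ΓSpecIso (.of R)).inv ≫ 𝒳.hom.appLE ⊤ V₁ le_top) r) =
      stalkHom 𝒳 ((fst 𝒳 𝒳).left.base (D.ι.base (iT.base w))) r := by
    simp only [Scheme.Hom.appLE, CommRingCat.hom_comp, stalkHom, globalHom, RingHom.coe_comp,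
      Function.comp_apply]
    rw [TopCat.Presheaf.germ_res_apply 𝒳.left.presheaf]
    rfl
  have r2 : (fst 𝒳 𝒳).left.stalkMap (D.ι.base (iT.base w))
      (stalkHom 𝒳 ((fst 𝒳 𝒳).left.base (D.ι.base (iT.base w))) r) =
      stalkHom (𝒳 ⊗ 𝒳) (D.ι.base (iT.base w)) r :=
    stalkMap_stalkHom_of_comp_eq (𝒳 := 𝒳) (𝒴 := 𝒳 ⊗ 𝒳) (fst 𝒳 𝒳).left hY₁ _ r
  have r3 : D.ι.stalkMap (iT.base w) (stalkHom (𝒳 ⊗ 𝒳) (D.ι.base (iT.base w)) r) =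
      stalkHom (Over.mk (D.ι ≫ (𝒳 ⊗ 𝒳).hom) : Over (Spec (.of R))) (iT.base w) r :=
    stalkMap_stalkHom_of_comp_eq (𝒳 := 𝒳 ⊗ 𝒳) (𝒴 := Over.mk (D.ι ≫ (𝒳 ⊗ 𝒳).hom)) D.ι rfl _ r
  change p (invJ (πT.stalkMap w ((Spec (.of K)).presheaf.germ ⊤ (πT.base w) trivial
      ((Scheme.ΓSpecIso (.of K)).inv (algebraMap R K r))))) = _
  rw [l2, l3, l4, r1, r2, r3]

set_option maxHeartbeats 400000 in
omit [IsOpenImmersion (specGenericPoint R K)] in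
/-- **The shear cocycle has a germ of residue `1` at a point of a slice fixed by the shear** (the `hpin` input of
the L4c′ closer; [BLRNeronModels1990] §4.3 / [EdixhovenRomagny2012] Thm. 6.3, the `ω`-argument at the origin
«`Φ^* ω = ω` at `(ε, ε)`»).  Binders: those of ★ `isUnitAt_shearCocycle_of_mem_genericFibre`, then the slice
`(T, w, iT, J, πT, x)` with `J = iT ≫ ι ≫ pr₂` an isomorphism on local rings at `w`, `iT ≫ ι ≫ pr₁ = πT ≫ x` for a
`K`-point `x` of the generic fibre, and `iT ≫ Φ = iT ≫ ι`.  Conclusion: a germ `t` at `z = ι (iT w)` of the cocycle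
`σ(pr₂♯ f₀) · B₂.det (d σ(pr₂♯ yᵢ))ᵢ · (pr₂♯ f₀)⁻¹` with `residue t = 1`.
[cite: BLRNeronModels1990, §4.3 (Prop. 6, proof)] [cite: EdixhovenRomagny2012, Thm. 6.3 (proof)] -/
theorem exists_germ_shearCocycle_residue_eq_one
    (hRK : algebraMap R 𝒳.left.functionField = stalkHom 𝒳 (genericPoint 𝒳.left))
    (hLM : algebraMap 𝒳.left.functionField (𝒳 ⊗ 𝒳).left.functionField =
      functionFieldMap (fst 𝒳 𝒳).left)
    (D : (𝒳 ⊗ 𝒳).left.Opens) [Nonempty D] [IsDominant D.ι]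
    (ΦD : (D : Scheme.{u}) ⟶ (𝒳 ⊗ 𝒳).left) [IsDominant ΦD]
    (hΦ₁ : ΦD ≫ (fst 𝒳 𝒳).left = D.ι ≫ (fst 𝒳 𝒳).left)
    (hiso : ∀ qD : ↥(D : Scheme.{u}),
      (𝒳 ⊗ 𝒳).hom.base (D.ι.base qD) ∈ Set.range (specGenericPoint R K).base → IsIso (ΦD.stalkMap qD))
    (σ : (𝒳 ⊗ 𝒳).left.functionField →+* (𝒳 ⊗ 𝒳).left.functionField)
    (hσ : (functionFieldMap D.ι).comp σ = functionFieldMap ΦD)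
    -- the top form `θ = (f₀, y)` on `𝒳`, a frame at every point of the generic fibre
    (f₀ : 𝒳.left.functionField) (y : Fin n → 𝒳.left.functionField)
    (B₀ : Module.Basis (Fin n) 𝒳.left.functionField Ω[𝒳.left.functionField⁄R])
    (hB₀ : ∀ i, B₀ i = KaehlerDifferential.D R _ (y i))
    (hθ : ∀ (p : 𝒳.left) (_ : 𝒳.hom.base p ∈ Set.range (specGenericPoint R K).base)
        (z : Fin n → 𝒳.left.presheaf.stalk p)
        (b : letI := (stalkHom 𝒳 p).toAlgebra
          Module.Basis (Fin n) (𝒳.left.presheaf.stalk p) Ω[𝒳.left.presheaf.stalk p⁄R])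
        (_ : letI := (stalkHom 𝒳 p).toAlgebra; ∀ i, b i = KaehlerDifferential.D R _ (z i))
        (B : Module.Basis (Fin n) 𝒳.left.functionField Ω[𝒳.left.functionField⁄R])
        (_ : ∀ i, B i = KaehlerDifferential.D R _ (toFunctionField p (z i))),
        IsUnitAt p (f₀ * B.det B₀))
    -- the relative basis `B₂ = d_{K(𝒳)} (pr₂♯ yᵢ)` (C5′)
    (B₂ : Module.Basis (Fin n) (𝒳 ⊗ 𝒳).left.functionField
        Ω[(𝒳 ⊗ 𝒳).left.functionField⁄𝒳.left.functionField])
    (hB₂ : ∀ i, B₂ i = KaehlerDifferential.D 𝒳.left.functionField _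
        (functionFieldMap (snd 𝒳 𝒳).left (y i)))
    -- the slice through the `K`-point `x`, fixed by `Φ`
    {T : Scheme.{u}} (w : T) (iT : T ⟶ (D : Scheme.{u})) (J : T ⟶ 𝒳.left) [IsIso (J.stalkMap w)]
    (hJ : iT ≫ D.ι ≫ (snd 𝒳 𝒳).left = J)
    (πT : T ⟶ Spec (.of K)) (x : Spec (.of K) ⟶ 𝒳.left) (hx : x ≫ 𝒳.hom = specGenericPoint R K)
    (hconst : iT ≫ D.ι ≫ (fst 𝒳 𝒳).left = πT ≫ x)
    (hfix : iT ≫ ΦD = iT ≫ D.ι) :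
    ∃ t : (𝒳 ⊗ 𝒳).left.presheaf.stalk (D.ι.base (iT.base w)),
      toFunctionField (D.ι.base (iT.base w)) t =
        σ (functionFieldMap (snd 𝒳 𝒳).left f₀) *
          B₂.det (fun i => KaehlerDifferential.D 𝒳.left.functionField _
            (σ (functionFieldMap (snd 𝒳 𝒳).left (y i)))) *
          (functionFieldMap (snd 𝒳 𝒳).left f₀)⁻¹ ∧
      IsLocalRing.residue _ t = 1 := by
  classical
  subst hJ
  have hY₁ : (fst 𝒳 𝒳).left ≫ 𝒳.hom = (𝒳 ⊗ 𝒳).hom := Over.w _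
  have hY₂ : (snd 𝒳 𝒳).left ≫ 𝒳.hom = (𝒳 ⊗ 𝒳).hom := Over.w _
  -- ### the point `q := iT w` of `D` and `z := ι q`; `Φ q = z`; `z` lies over the generic point
  have hzΦ : ΦD.base (iT.base w) = D.ι.base (iT.base w) := by
    have h := congrArg (fun φ => φ.base w) hfix
    simpa only [Scheme.Hom.comp_base, TopCat.comp_app] using h
  have hz₁ : (fst 𝒳 𝒳).left.base (D.ι.base (iT.base w)) = x.base (πT.base w) := by
    have h := congrArg (fun φ => φ.base w) hconst
    simpa only [Scheme.Hom.comp_base, TopCat.comp_app] using h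
  have hq : (𝒳 ⊗ 𝒳).hom.base (D.ι.base (iT.base w)) ∈ Set.range (specGenericPoint R K).base := by
    refine ⟨πT.base w, ?_⟩
    have h := congrArg (fun φ => φ.base (D.ι.base (iT.base w))) hY₁
    simp only [Scheme.Hom.comp_base, TopCat.comp_app] at h
    have h' := congrArg (fun φ => φ.base (πT.base w)) hx
    simp only [Scheme.Hom.comp_base, TopCat.comp_app] at h'
    rw [← h, hz₁, h']
  haveI : IsIso (ΦD.stalkMap (iT.base w)) := hiso (iT.base w) hq
  have hQ'₁ : (fst 𝒳 𝒳).left.base (ΦD.base (iT.base w)) = (fst 𝒳 𝒳).left.base (D.ι.base (iT.base w)) := by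
    rw [hzΦ]
  have hq' : (𝒳 ⊗ 𝒳).hom.base (ΦD.base (iT.base w)) ∈ Set.range (specGenericPoint R K).base := by
    rw [hzΦ]; exact hq
  -- ### charts (★ C1): `V₁ ∋ pr₁ z` (scalars) and `V₂ ∋ pr₂ z = pr₂ (Φ q)` (coordinates)
  obtain ⟨V₁, hV₁, h₁V, -, -⟩ := exists_affineChart_basis_eq_D 𝒳.hom n ((fst 𝒳 𝒳).left.base (D.ι.base (iT.base w)))
  obtain ⟨V₂, hV₂, h₂V, y₂, b₂, hb₂⟩ := exists_affineChart_basis_eq_D 𝒳.hom n ((snd 𝒳 𝒳).left.base (D.ι.base (iT.base w)))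
  letI algV₁ : Algebra R Γ(𝒳.left, V₁) :=
    ((Scheme.ΓSpecIso (.of R)).inv ≫ 𝒳.hom.appLE ⊤ V₁ le_top).hom.toAlgebra
  letI algV₂ : Algebra R Γ(𝒳.left, V₂) :=
    ((Scheme.ΓSpecIso (.of R)).inv ≫ 𝒳.hom.appLE ⊤ V₂ le_top).hom.toAlgebra
  haveI : Nonempty V₁ := ⟨⟨_, h₁V⟩⟩
  haveI : Nonempty V₂ := ⟨⟨_, h₂V⟩⟩
  have h₁V' : (fst 𝒳 𝒳).left.base (ΦD.base (iT.base w)) ∈ V₁ := by rw [hQ'₁]; exact h₁V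
  have h₃V : (snd 𝒳 𝒳).left.base (ΦD.base (iT.base w)) ∈ V₂ := by rw [hzΦ]; exact h₂V
  -- ### the base ring `A := Γ(𝒳, V₁)` and its actions (through `pr₁`)
  letI algAY : Algebra Γ(𝒳.left, V₁) (𝒳 ⊗ 𝒳).left.functionField :=
    ((functionFieldMap (fst 𝒳 𝒳).left).comp (algebraMap Γ(𝒳.left, V₁) 𝒳.left.functionField)).toAlgebra
  letI algAD : Algebra Γ(𝒳.left, V₁) (D : Scheme.{u}).functionField :=
    ((functionFieldMap D.ι).comp (algebraMap Γ(𝒳.left, V₁) (𝒳 ⊗ 𝒳).left.functionField)).toAlgebra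
  letI algAQ : Algebra Γ(𝒳.left, V₁) ((𝒳 ⊗ 𝒳).left.presheaf.stalk (D.ι.base (iT.base w))) :=
    (((fst 𝒳 𝒳).left.stalkMap (D.ι.base (iT.base w))).hom.comp
      (𝒳.left.presheaf.germ V₁ _ h₁V).hom).toAlgebra
  letI algAQ' : Algebra Γ(𝒳.left, V₁) ((𝒳 ⊗ 𝒳).left.presheaf.stalk (ΦD.base (iT.base w))) :=
    (((fst 𝒳 𝒳).left.stalkMap (ΦD.base (iT.base w))).hom.comp
      (𝒳.left.presheaf.germ V₁ _ h₁V').hom).toAlgebra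
  letI algAqD : Algebra Γ(𝒳.left, V₁) ((D : Scheme.{u}).presheaf.stalk (iT.base w)) :=
    ((D.ι.stalkMap (iT.base w)).hom.comp
      (algebraMap Γ(𝒳.left, V₁) ((𝒳 ⊗ 𝒳).left.presheaf.stalk (D.ι.base (iT.base w))))).toAlgebra
  haveI towQ : IsScalarTower Γ(𝒳.left, V₁) ((𝒳 ⊗ 𝒳).left.presheaf.stalk (D.ι.base (iT.base w)))
      (𝒳 ⊗ 𝒳).left.functionField :=
    isScalarTower_stalk_functionField_of_algebraMap_eq (fst 𝒳 𝒳).left (D.ι.base (iT.base w)) h₁V rfl rfl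
  haveI towQ' : IsScalarTower Γ(𝒳.left, V₁) ((𝒳 ⊗ 𝒳).left.presheaf.stalk (ΦD.base (iT.base w)))
      (𝒳 ⊗ 𝒳).left.functionField :=
    isScalarTower_stalk_functionField_of_algebraMap_eq (fst 𝒳 𝒳).left (ΦD.base (iT.base w)) h₁V' rfl rfl
  haveI towqD : IsScalarTower Γ(𝒳.left, V₁) ((D : Scheme.{u}).presheaf.stalk (iT.base w))
      (D : Scheme.{u}).functionField := by
    refine IsScalarTower.of_algebraMap_eq fun a => ?_
    change functionFieldMap D.ι (algebraMap Γ(𝒳.left, V₁) (𝒳 ⊗ 𝒳).left.functionField a) =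
      toFunctionField (iT.base w) (D.ι.stalkMap (iT.base w) (algebraMap Γ(𝒳.left, V₁) _ a))
    rw [IsScalarTower.algebraMap_apply Γ(𝒳.left, V₁) ((𝒳 ⊗ 𝒳).left.presheaf.stalk (D.ι.base (iT.base w)))
      (𝒳 ⊗ 𝒳).left.functionField a, functionFieldMap_toFunctionField]
  -- compatibilities of the `A`-structures with `ι = D.ι` and `Φ = ΦD`
  have hAι : (D.ι.stalkMap (iT.base w)).hom.comp
      (algebraMap Γ(𝒳.left, V₁) ((𝒳 ⊗ 𝒳).left.presheaf.stalk (D.ι.base (iT.base w)))) =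
      algebraMap Γ(𝒳.left, V₁) ((D : Scheme.{u}).presheaf.stalk (iT.base w)) := rfl
  have hιA : (functionFieldMap D.ι).comp (algebraMap Γ(𝒳.left, V₁) (𝒳 ⊗ 𝒳).left.functionField) =
      algebraMap Γ(𝒳.left, V₁) (D : Scheme.{u}).functionField := rfl
  have hAΦ : (ΦD.stalkMap (iT.base w)).hom.comp
      (algebraMap Γ(𝒳.left, V₁) ((𝒳 ⊗ 𝒳).left.presheaf.stalk (ΦD.base (iT.base w)))) =
      algebraMap Γ(𝒳.left, V₁) ((D : Scheme.{u}).presheaf.stalk (iT.base w)) := by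
    -- both sides are `a ↦ germ_{(iT.base w)} ((g)^* a)` for `g = ΦD ≫ pr₁ = ι ≫ pr₁`
    have hgen : ∀ (g₁ g₂ : (D : Scheme.{u}) ⟶ 𝒳.left) (_ : g₁ = g₂) (h₁ : g₁.base (iT.base w) ∈ V₁)
        (h₂ : g₂.base (iT.base w) ∈ V₁) (a : Γ(𝒳.left, V₁)),
        (D : Scheme.{u}).presheaf.germ (g₁ ⁻¹ᵁ V₁) (iT.base w) h₁ (g₁.app V₁ a) =
          (D : Scheme.{u}).presheaf.germ (g₂ ⁻¹ᵁ V₁) (iT.base w) h₂ (g₂.app V₁ a) := by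
      rintro g₁ _ rfl h₁ h₂ a; rfl
    have hm₁ : (ΦD ≫ (fst 𝒳 𝒳).left).base (iT.base w) ∈ V₁ := by
      rw [Scheme.Hom.comp_base, TopCat.comp_app]; exact h₁V'
    have hm₂ : (D.ι ≫ (fst 𝒳 𝒳).left).base (iT.base w) ∈ V₁ := by
      rw [Scheme.Hom.comp_base, TopCat.comp_app]; exact h₁V
    ext a
    change ΦD.stalkMap (iT.base w) (((fst 𝒳 𝒳).left.stalkMap (ΦD.base (iT.base w)))
        (𝒳.left.presheaf.germ V₁ _ h₁V' a)) =
      D.ι.stalkMap (iT.base w) (((fst 𝒳 𝒳).left.stalkMap (D.ι.base (iT.base w))) (𝒳.left.presheaf.germ V₁ _ h₁V a))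
    rw [Scheme.Hom.germ_stalkMap_apply, Scheme.Hom.germ_stalkMap_apply,
      Scheme.Hom.germ_stalkMap_apply, Scheme.Hom.germ_stalkMap_apply]
    have e := hgen _ _ hΦ₁ hm₁ hm₂ a
    simp only [Scheme.Hom.comp_app] at e
    exact e
  have hΦA : (functionFieldMap ΦD).comp (algebraMap Γ(𝒳.left, V₁) (𝒳 ⊗ 𝒳).left.functionField) =
      algebraMap Γ(𝒳.left, V₁) (D : Scheme.{u}).functionField := by
    have e3 : functionFieldMap (ΦD ≫ (fst 𝒳 𝒳).left) = functionFieldMap (D.ι ≫ (fst 𝒳 𝒳).left) := by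
      congr 1
    change (functionFieldMap ΦD).comp ((functionFieldMap (fst 𝒳 𝒳).left).comp
        (algebraMap Γ(𝒳.left, V₁) 𝒳.left.functionField)) =
      (functionFieldMap D.ι).comp ((functionFieldMap (fst 𝒳 𝒳).left).comp
        (algebraMap Γ(𝒳.left, V₁) 𝒳.left.functionField))
    rw [← RingHom.comp_assoc, ← RingHom.comp_assoc, ← functionFieldMap_comp (fst 𝒳 𝒳).left ΦD,
      ← functionFieldMap_comp (fst 𝒳 𝒳).left D.ι, e3]
  -- ### relative coordinates at `z` and at `Φ q` (★ PCS-R): the germs `pr₂♯ yᵢ`, and their function-field bases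
  obtain ⟨b, hb⟩ := exists_basis_stalk_tensorObj_eq_D 𝒳 𝒳 hV₁ hV₂ rfl rfl b₂ hb₂
    (D.ι.base (iT.base w)) h₁V h₂V rfl
  obtain ⟨b', hb'⟩ := exists_basis_stalk_tensorObj_eq_D 𝒳 𝒳 hV₁ hV₂ rfl rfl b₂ hb₂
    (ΦD.base (iT.base w)) h₁V' h₃V rfl
  have hw : ∀ i, toFunctionField (D.ι.base (iT.base w))
      ((snd 𝒳 𝒳).left.stalkMap (D.ι.base (iT.base w))
        (𝒳.left.presheaf.germ V₂ ((snd 𝒳 𝒳).left.base (D.ι.base (iT.base w))) h₂V (y₂ i))) =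
      functionFieldMap (snd 𝒳 𝒳).left (algebraMap Γ(𝒳.left, V₂) 𝒳.left.functionField (y₂ i)) :=
    fun i => toFunctionField_stalkMap_germ (snd 𝒳 𝒳).left _ h₂V (y₂ i)
  have hw' : ∀ i, toFunctionField (ΦD.base (iT.base w))
      ((snd 𝒳 𝒳).left.stalkMap (ΦD.base (iT.base w))
        (𝒳.left.presheaf.germ V₂ ((snd 𝒳 𝒳).left.base (ΦD.base (iT.base w))) h₃V (y₂ i))) =
      functionFieldMap (snd 𝒳 𝒳).left (algebraMap Γ(𝒳.left, V₂) 𝒳.left.functionField (y₂ i)) :=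
    fun i => toFunctionField_stalkMap_germ (snd 𝒳 𝒳).left _ h₃V (y₂ i)
  obtain ⟨W₁, hW₁⟩ := exists_basis_functionField_of_localCoordinates' n Γ(𝒳.left, V₁) b hb
  obtain ⟨W', hW'⟩ := exists_basis_functionField_of_localCoordinates' n Γ(𝒳.left, V₁) b' hb'
  -- the two function-field bases coincide (same coordinates `pr₂♯ yᵢ`)
  have hWW : W' = W₁ := Module.Basis.eq_of_apply_eq fun i => by rw [hW', hW₁, hw, hw']
  -- ### the top form over `A`: `B = d_A (pr₂♯ yᵢ)` from `B₂` (base switch `Γ(V₁) → K(𝒳)`, a localisation)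
  haveI towAXY : IsScalarTower Γ(𝒳.left, V₁) 𝒳.left.functionField (𝒳 ⊗ 𝒳).left.functionField :=
    IsScalarTower.of_algebraMap_eq fun a => by rw [hLM]; rfl
  haveI : IsFractionRing Γ(𝒳.left, V₁) 𝒳.left.functionField :=
    functionField_isFractionRing_of_isAffineOpen 𝒳.left V₁ hV₁
  let eΩ := Literature.RingTheory.Localization.kaehlerDifferentialEquivOfIsLocalization Γ(𝒳.left, V₁)
    𝒳.left.functionField (𝒳 ⊗ 𝒳).left.functionField (nonZeroDivisors Γ(𝒳.left, V₁))
  let B : Module.Basis (Fin n) (𝒳 ⊗ 𝒳).left.functionField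
      Ω[(𝒳 ⊗ 𝒳).left.functionField⁄Γ(𝒳.left, V₁)] := B₂.map eΩ.symm
  have hB : ∀ i, B i = KaehlerDifferential.D Γ(𝒳.left, V₁) _ (functionFieldMap (snd 𝒳 𝒳).left (y i)) := by
    intro i
    change eΩ.symm (B₂ i) = _
    rw [hB₂, LinearEquiv.symm_apply_eq,
      Literature.RingTheory.Localization.kaehlerDifferentialEquivOfIsLocalization_D]
  -- ### the frames at `z` and at `Φ q`: pull-backs of a unit `g₀` at `x₀` (chain rule along `pr₂♯`)
  -- `R → Γ(V₁) → K(𝒳)` is `R → K(𝒳)`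
  have hRV₁ : (algebraMap Γ(𝒳.left, V₁) 𝒳.left.functionField).comp (algebraMap R Γ(𝒳.left, V₁)) =
      algebraMap R 𝒳.left.functionField := by
    ext r
    rw [hRK]
    change 𝒳.left.presheaf.germ V₁ (genericPoint 𝒳.left) _
        (((Scheme.ΓSpecIso (.of R)).inv ≫ 𝒳.hom.appLE ⊤ V₁ le_top) r) = _
    simp only [Scheme.Hom.appLE, CommRingCat.hom_comp, stalkHom, globalHom, RingHom.coe_comp,
      Function.comp_apply]
    rw [TopCat.Presheaf.germ_res_apply 𝒳.left.presheaf]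
    rfl
  -- `pr₂♯ ∘ (R → K(𝒳)) = (Γ(V₁) → K(Y)) ∘ (R → Γ(V₁))`: both are `R → K(Y)`
  have hστ : (functionFieldMap (snd 𝒳 𝒳).left).comp (algebraMap R 𝒳.left.functionField) =
      (algebraMap Γ(𝒳.left, V₁) (𝒳 ⊗ 𝒳).left.functionField).comp (algebraMap R Γ(𝒳.left, V₁)) := by
    change _ = ((functionFieldMap (fst 𝒳 𝒳).left).comp
      (algebraMap Γ(𝒳.left, V₁) 𝒳.left.functionField)).comp (algebraMap R Γ(𝒳.left, V₁))
    rw [RingHom.comp_assoc, hRV₁, hRK, functionFieldMap_comp_stalkHom (snd 𝒳 𝒳),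
      functionFieldMap_comp_stalkHom (fst 𝒳 𝒳)]
  obtain ⟨g₀, hg₀, hg₀'⟩ := exists_frame_functionFieldMap_snd K 𝒳 n hRK f₀ y B₀ hB₀ hθ hστ B hB hq hV₂ h₂V rfl
    b₂ hb₂ hw W₁ hW₁
  have hq₁ : IsUnitAt (D.ι.base (iT.base w)) (functionFieldMap (snd 𝒳 𝒳).left f₀ * W₁.det B) := by
    rw [← hg₀']; exact hg₀.functionFieldMap
  have hq₂ : IsUnitAt (ΦD.base (iT.base w)) (functionFieldMap (snd 𝒳 𝒳).left f₀ * W'.det B) := by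
    obtain ⟨g₀', hg, hg'⟩ := exists_frame_functionFieldMap_snd K 𝒳 n hRK f₀ y B₀ hB₀ hθ hστ B hB hq' hV₂ h₃V
      rfl b₂ hb₂ hw' W' hW'
    rw [← hg']; exact hg.functionFieldMap
  -- ### the basis `C = d_A (ι♯ pr₂♯ yᵢ)` on `K(D)` and the GERM form of F1
  obtain ⟨C, hC⟩ := exists_basis_of_bijective_eq_D (functionFieldMap D.ι)
    (functionFieldMap_bijective_of_isOpenImmersion D.ι) hιA B hB
  obtain ⟨bq, hbq, t', ht', t₁, ht₁, hgerm⟩ := exists_germs_cocycle_eq ΦD D.ι n Γ(𝒳.left, V₁) (iT.base w)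
    hAΦ hAι hΦA hιA b hb W₁ hW₁ b' hb' W' hW' (functionFieldMap (snd 𝒳 𝒳).left f₀) B hB hq₁ hq₂ C hC
  -- ### `ι♯ c` is the right-hand side of `hgerm`
  have hισ : ∀ x, functionFieldMap D.ι (σ x) = functionFieldMap ΦD x := fun x => RingHom.congr_fun hσ x
  -- base switch `Γ(V₁) → K(𝒳)` for the determinant, then the chain rule along `ι♯`
  have hτK : (RingHom.id (𝒳 ⊗ 𝒳).left.functionField).comp
      (algebraMap Γ(𝒳.left, V₁) (𝒳 ⊗ 𝒳).left.functionField) =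
      (algebraMap 𝒳.left.functionField (𝒳 ⊗ 𝒳).left.functionField).comp
        (algebraMap Γ(𝒳.left, V₁) 𝒳.left.functionField) := by
    rw [RingHom.id_comp, ← IsScalarTower.algebraMap_eq]
  have hB₂' : ∀ i, B₂ i = KaehlerDifferential.D 𝒳.left.functionField _
      (RingHom.id _ (functionFieldMap (snd 𝒳 𝒳).left (y i))) := fun i => by
    rw [hB₂, RingHom.id_apply]
  have hdet₁ : B₂.det (fun i => KaehlerDifferential.D 𝒳.left.functionField _
      (σ (functionFieldMap (snd 𝒳 𝒳).left (y i)))) =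
      B.det (fun i => KaehlerDifferential.D Γ(𝒳.left, V₁) _
        (σ (functionFieldMap (snd 𝒳 𝒳).left (y i)))) := by
    have h := det_D_ringHom_eq (algebraMap Γ(𝒳.left, V₁) 𝒳.left.functionField) (RingHom.id _)
      hτK B hB B₂ hB₂' (fun i => σ (functionFieldMap (snd 𝒳 𝒳).left (y i)))
    simpa only [RingHom.id_apply] using h
  have hdet₂ : functionFieldMap D.ι (B.det (fun i => KaehlerDifferential.D Γ(𝒳.left, V₁) _
      (σ (functionFieldMap (snd 𝒳 𝒳).left (y i))))) =
      C.det (fun i => KaehlerDifferential.D Γ(𝒳.left, V₁) _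
        (functionFieldMap ΦD (functionFieldMap (snd 𝒳 𝒳).left (y i)))) := by
    have h := det_D_ringHom_eq (RingHom.id Γ(𝒳.left, V₁)) (functionFieldMap D.ι)
      (by rw [hιA, RingHom.comp_id]) B hB C hC (fun i => σ (functionFieldMap (snd 𝒳 𝒳).left (y i)))
    rw [← h]
    simp only [hισ]
  have hcD : functionFieldMap D.ι (σ (functionFieldMap (snd 𝒳 𝒳).left f₀) *
      B₂.det (fun i => KaehlerDifferential.D 𝒳.left.functionField _
        (σ (functionFieldMap (snd 𝒳 𝒳).left (y i)))) *
      (functionFieldMap (snd 𝒳 𝒳).left f₀)⁻¹) =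
      functionFieldMap ΦD (functionFieldMap (snd 𝒳 𝒳).left f₀) *
        C.det (fun i => KaehlerDifferential.D Γ(𝒳.left, V₁) _
          (functionFieldMap ΦD (functionFieldMap (snd 𝒳 𝒳).left (y i)))) *
        (functionFieldMap D.ι (functionFieldMap (snd 𝒳 𝒳).left f₀))⁻¹ := by
    rw [map_mul, map_mul, map_inv₀, hισ, hdet₁, hdet₂]
  -- ### the germ on `Y`: pull `tD` back through the isomorphism `ι♯_q`
  have hinv : ∀ v, D.ι.stalkMap (iT.base w) ((inv (D.ι.stalkMap (iT.base w))) v) = v := fun v => by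
    rw [← CommRingCat.comp_apply, IsIso.inv_hom_id, CommRingCat.id_apply]
  refine ⟨(inv (D.ι.stalkMap (iT.base w))) (ΦD.stalkMap (iT.base w) (t' : (𝒳 ⊗ 𝒳).left.presheaf.stalk _) *
      bq.det (fun i => KaehlerDifferential.D Γ(𝒳.left, V₁) _ (ΦD.stalkMap (iT.base w)
        ((snd 𝒳 𝒳).left.stalkMap (ΦD.base (iT.base w))
          (𝒳.left.presheaf.germ V₂ ((snd 𝒳 𝒳).left.base (ΦD.base (iT.base w))) h₃V (y₂ i))))) *
      ((Units.map (D.ι.stalkMap (iT.base w)).hom.toMonoidHom t₁)⁻¹ : ((D : Scheme.{u}).presheaf.stalk _)ˣ)), ?_, ?_⟩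
  · -- the rational function is `c`: check after `ι♯` (injective)
    apply (functionFieldMap D.ι).injective
    rw [functionFieldMap_toFunctionField D.ι (iT.base w), hinv, hgerm, hcD]
  -- ### the residue is `1`
  -- the two ring maps `p := (ι ≫ pr₂)♯_q`, `μ := (Φ ≫ pr₂)♯_q : 𝒪_{𝒳, x₀} → 𝒪_{D, q}` (`x₀ = pr₂ z`) and the
  -- retraction `s := (J♯_w)⁻¹ ∘ iT♯_w`; all typed at the point `x₀` written as `pr₂ (ι q)`
  have hspec : (snd 𝒳 𝒳).left.base (ΦD.base (iT.base w)) ⤳ (snd 𝒳 𝒳).left.base (D.ι.base (iT.base w)) := by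
    rw [hzΦ]
  let p : 𝒳.left.presheaf.stalk ((snd 𝒳 𝒳).left.base (D.ι.base (iT.base w))) →+*
      (D : Scheme.{u}).presheaf.stalk (iT.base w) :=
    ((D.ι ≫ (snd 𝒳 𝒳).left).stalkMap (iT.base w)).hom
  let spec' : 𝒳.left.presheaf.stalk ((snd 𝒳 𝒳).left.base (D.ι.base (iT.base w))) →+*
      𝒳.left.presheaf.stalk ((ΦD ≫ (snd 𝒳 𝒳).left).base (iT.base w)) :=
    (𝒳.left.presheaf.stalkSpecializes hspec).hom
  let μ : 𝒳.left.presheaf.stalk ((snd 𝒳 𝒳).left.base (D.ι.base (iT.base w))) →+*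
      (D : Scheme.{u}).presheaf.stalk (iT.base w) :=
    ((ΦD ≫ (snd 𝒳 𝒳).left).stalkMap (iT.base w)).hom.comp spec'
  let invJ : T.presheaf.stalk w →+* 𝒳.left.presheaf.stalk ((snd 𝒳 𝒳).left.base (D.ι.base (iT.base w))) :=
    (inv ((iT ≫ D.ι ≫ (snd 𝒳 𝒳).left).stalkMap w)).hom
  let s : (D : Scheme.{u}).presheaf.stalk (iT.base w) →+*
      𝒳.left.presheaf.stalk ((snd 𝒳 𝒳).left.base (D.ι.base (iT.base w))) :=
    invJ.comp (iT.stalkMap w).hom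
  have hp_apply : ∀ v, p v = D.ι.stalkMap (iT.base w) ((snd 𝒳 𝒳).left.stalkMap (D.ι.base (iT.base w)) v) :=
    fun v => congrArg (fun φ => φ.hom v) (Scheme.Hom.stalkMap_comp D.ι (snd 𝒳 𝒳).left (iT.base w))
  have hμ_apply : ∀ v, μ v = ΦD.stalkMap (iT.base w) ((snd 𝒳 𝒳).left.stalkMap (ΦD.base (iT.base w))
      (𝒳.left.presheaf.stalkSpecializes hspec v)) :=
    fun v => congrArg (fun φ => φ.hom (𝒳.left.presheaf.stalkSpecializes hspec v))
      (Scheme.Hom.stalkMap_comp ΦD (snd 𝒳 𝒳).left (iT.base w))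
  obtain ⟨hsp', hsμ'⟩ := slice_section_retracts iT D.ι ΦD (snd 𝒳 𝒳).left w hfix hspec
  have hsp : ∀ g, s (p g) = g := fun g => hsp' g
  have hsμ : ∀ g, s (μ g) = g := fun g => hsμ' g
  -- ### the `pr₁`-scalars become constants from `K` along the slice: `d_A (p (s a)) = 0`
  -- the composite `K → 𝒪_{Spec K, πT w} → 𝒪_{T, w} → 𝒪_{𝒳, x₀} → 𝒪_{D, q}`; it is an `R`-algebra map
  let ψK : K →+* (D : Scheme.{u}).presheaf.stalk (iT.base w) :=
    p.comp ((invJ.comp (πT.stalkMap w).hom).comp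
      (((Spec (.of K)).presheaf.germ ⊤ (πT.base w) trivial).hom.comp (Scheme.ΓSpecIso (.of K)).inv.hom))
  have hψK : ∀ r, ψK (algebraMap R K r) =
      algebraMap Γ(𝒳.left, V₁) ((D : Scheme.{u}).presheaf.stalk (iT.base w)) (algebraMap R _ r) :=
    fun r => slice_scalar_eq K 𝒳 D w iT πT x hx hconst V₁ h₁V r
  have hA' : ∀ a, KaehlerDifferential.D Γ(𝒳.left, V₁) ((D : Scheme.{u}).presheaf.stalk (iT.base w))
      (p (s (algebraMap Γ(𝒳.left, V₁) _ a))) ∈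
      (maximalIdeal ((D : Scheme.{u}).presheaf.stalk (iT.base w))) •
        (⊤ : Submodule ((D : Scheme.{u}).presheaf.stalk (iT.base w))
          Ω[((D : Scheme.{u}).presheaf.stalk (iT.base w))⁄Γ(𝒳.left, V₁)]) := by
    intro a
    -- `iT♯ (algebraMap a) = πT♯ (x♯ (germ a))`: the scalar is constant along the slice
    obtain ⟨f, hf⟩ : ∃ f, iT.stalkMap w (algebraMap Γ(𝒳.left, V₁)
        ((D : Scheme.{u}).presheaf.stalk (iT.base w)) a) = πT.stalkMap w f := by
      have e1 : iT.stalkMap w (algebraMap Γ(𝒳.left, V₁) ((D : Scheme.{u}).presheaf.stalk (iT.base w)) a) =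
          (iT ≫ D.ι ≫ (fst 𝒳 𝒳).left).stalkMap w (𝒳.left.presheaf.germ V₁ _ h₁V a) := by
        rw [Scheme.Hom.stalkMap_comp, Scheme.Hom.stalkMap_comp]; rfl
      rw [Scheme.Hom.stalkMap_congr_hom _ _ hconst w, Scheme.Hom.stalkMap_comp πT x w] at e1
      exact ⟨_, e1⟩
    obtain ⟨k, hk⟩ := exists_germ_ΓSpecIso_inv_eq (πT.base w) f
    have e2 : p (s (algebraMap Γ(𝒳.left, V₁) ((D : Scheme.{u}).presheaf.stalk (iT.base w)) a)) = ψK k := by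
      change p (invJ (iT.stalkMap w (algebraMap _ _ a))) = p (invJ (πT.stalkMap w
        ((Spec (.of K)).presheaf.germ ⊤ (πT.base w) trivial ((Scheme.ΓSpecIso (.of K)).inv k))))
      rw [hf, hk]
    rw [e2, kaehlerDifferential_D_eq_zero_of_isFractionRing ψK hψK k]
    exact zero_mem _
  -- ### the Jacobian factor has residue `1` (★ PIN-2b core)
  have hbq' : ∀ i, bq i = KaehlerDifferential.D Γ(𝒳.left, V₁) _
      (p (𝒳.left.presheaf.germ V₂ _ h₂V (y₂ i))) := fun i => by
    rw [hbq, hp_apply]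
  have hJac := residue_det_eq_one_of_section p μ s hsp hsμ hA' _ bq hbq'
  have hμζ : ∀ i, μ (𝒳.left.presheaf.germ V₂ _ h₂V (y₂ i)) = ΦD.stalkMap (iT.base w)
      ((snd 𝒳 𝒳).left.stalkMap (ΦD.base (iT.base w))
        (𝒳.left.presheaf.germ V₂ ((snd 𝒳 𝒳).left.base (ΦD.base (iT.base w))) h₃V (y₂ i))) := fun i => by
    rw [hμ_apply, TopCat.Presheaf.germ_stalkSpecializes_apply]
  simp only [hμζ] at hJac
  -- ### the two unit germs: `Φ♯ t' = μ u₀`, `ι♯ t₁ = p u₀` for the unit germ `u₀` of `g₀` at `x₀`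
  obtain ⟨u₀, hu₀⟩ := hg₀
  have hU₁ : D.ι.stalkMap (iT.base w) (t₁ : (𝒳 ⊗ 𝒳).left.presheaf.stalk _) =
      p (u₀ : 𝒳.left.presheaf.stalk _) := by
    apply toFunctionField_injective (iT.base w)
    rw [hp_apply, ← functionFieldMap_toFunctionField D.ι (iT.base w),
      ← functionFieldMap_toFunctionField D.ι (iT.base w), ht₁,
      ← functionFieldMap_toFunctionField (snd 𝒳 𝒳).left (D.ι.base (iT.base w)), hu₀, hg₀']
  have hts : toFunctionField ((snd 𝒳 𝒳).left.base (ΦD.base (iT.base w)))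
      (𝒳.left.presheaf.stalkSpecializes hspec (u₀ : 𝒳.left.presheaf.stalk _)) =
      toFunctionField ((snd 𝒳 𝒳).left.base (D.ι.base (iT.base w))) (u₀ : 𝒳.left.presheaf.stalk _) := by
    simp only [toFunctionField, RingHom.algebraMap_toAlgebra]
    rw [← CommRingCat.comp_apply, TopCat.Presheaf.stalkSpecializes_comp]
  have hU' : ΦD.stalkMap (iT.base w) (t' : (𝒳 ⊗ 𝒳).left.presheaf.stalk _) =
      μ (u₀ : 𝒳.left.presheaf.stalk _) := by
    apply toFunctionField_injective (iT.base w)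
    rw [hμ_apply, ← functionFieldMap_toFunctionField ΦD (iT.base w),
      ← functionFieldMap_toFunctionField ΦD (iT.base w), ht', hWW,
      ← functionFieldMap_toFunctionField (snd 𝒳 𝒳).left (ΦD.base (iT.base w)),
      hts, hu₀, hg₀']
  have hres : residue _ (ΦD.stalkMap (iT.base w) (t' : (𝒳 ⊗ 𝒳).left.presheaf.stalk _)) =
      residue _ (D.ι.stalkMap (iT.base w) (t₁ : (𝒳 ⊗ 𝒳).left.presheaf.stalk _)) := by
    rw [hU', hU₁, ← residue_map_section_eq p s hsp (μ _), hsμ]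
  -- ### assemble: `residue tD = residue (ι♯ t₁) * 1 * residue (ι♯ t₁)⁻¹ = 1`
  have htD : residue _ (ΦD.stalkMap (iT.base w) (t' : (𝒳 ⊗ 𝒳).left.presheaf.stalk _) *
      bq.det (fun i => KaehlerDifferential.D Γ(𝒳.left, V₁) _ (ΦD.stalkMap (iT.base w)
        ((snd 𝒳 𝒳).left.stalkMap (ΦD.base (iT.base w))
          (𝒳.left.presheaf.germ V₂ ((snd 𝒳 𝒳).left.base (ΦD.base (iT.base w))) h₃V (y₂ i))))) *
      ((Units.map (D.ι.stalkMap (iT.base w)).hom.toMonoidHom t₁)⁻¹ : ((D : Scheme.{u}).presheaf.stalk _)ˣ)) = 1 := by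
    rw [map_mul, map_mul, hJac, mul_one, hres, Units.coe_map_inv, RingHom.toMonoidHom_eq_coe,
      MonoidHom.coe_coe, ← map_mul, ← map_mul, Units.mul_inv, map_one, map_one]
  -- ### back on `Y` through the local homomorphism `ι♯_q`
  have hmem : ∀ v : (𝒳 ⊗ 𝒳).left.presheaf.stalk (D.ι.base (iT.base w)),
      residue _ (D.ι.stalkMap (iT.base w) v) = 1 → residue _ v = 1 := by
    intro v hv
    have h1 : D.ι.stalkMap (iT.base w) v - 1 ∈ maximalIdeal _ := by
      rw [← residue_eq_zero_iff, map_sub, hv, map_one, sub_self]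
    have h2 : v - 1 ∈ maximalIdeal _ := by
      rw [mem_maximalIdeal, mem_nonunits_iff] at h1 ⊢
      intro hu
      apply h1
      have h3 := hu.map (D.ι.stalkMap (iT.base w)).hom
      rwa [map_sub, map_one] at h3
    rw [← residue_eq_zero_iff, map_sub, map_one, sub_eq_zero] at h2
    exact h2
  exact hmem _ (by rw [hinv]; exact htD)

/-! ### The `hpin` input at the unit point `(ε, ε)` -/

section UnitPoint

open scoped MonObj CategoryTheory.Obj

set_option backward.isDefEq.respectTransparency false in
/-- **`hpin`: the shear cocycle has a germ of residue `1` at the `K`-point `z = (ε, ε)`** — the input of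
★ `shear_identity_of_residue_eq_one` (B-p12's L4c′ closer), obtained from `exists_germ_shearCocycle_residue_eq_one`
on the UNIT SLICE `b ↦ (ε, b)` of the generic fibre (★ `exists_unitSlice_liftD`: the slice lands in `D`, is a
section of `pr₂` up to the open immersion `𝒳_K → 𝒳`, has constant first coordinate `ε`, and is fixed by `Φ` by the
unit law `m(ε, b) = b` of the group law of `E` — the only place where `E`, `e`, `hgen` enter), the germ being moved
from `ι (iT w)` to the syntactically different name `(x, x)` of the same point.
[cite: BLRNeronModels1990, §4.3 (Prop. 6, proof) and §4.2] [cite: EdixhovenRomagny2012, Thm. 6.3 (proof)] -/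
theorem exists_germ_shearCocycle_residue_eq_one_unitPoint
    (hRK : algebraMap R 𝒳.left.functionField = stalkHom 𝒳 (genericPoint 𝒳.left))
    (hLM : algebraMap 𝒳.left.functionField (𝒳 ⊗ 𝒳).left.functionField =
      functionFieldMap (fst 𝒳 𝒳).left)
    (E : Over (Spec (.of K))) [MonObj E] (e : (genericFibre R K).obj 𝒳 ≅ E)
    (D : (𝒳 ⊗ 𝒳).left.Opens) [Nonempty D] [IsDominant D.ι]
    (hD : (𝒳 ⊗ 𝒳).hom ⁻¹ᵁ (specGenericPoint R K).opensRange ≤ D)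
    (m : (D : Scheme.{u}) ⟶ 𝒳.left)
    (hgen : (𝒳 ⊗ 𝒳).left.homOfLE hD ≫ m =
      (IsOpenImmersion.isoOfRangeEq (pullback.fst (𝒳 ⊗ 𝒳).hom (specGenericPoint R K))
          ((𝒳 ⊗ 𝒳).hom ⁻¹ᵁ (specGenericPoint R K).opensRange).ι (by
            rw [Scheme.Opens.range_ι]
            exact IsOpenImmersion.range_pullbackFst (specGenericPoint R K) (𝒳 ⊗ 𝒳).hom)).inv ≫
        (Functor.OplaxMonoidal.δ (genericFibre R K) 𝒳 𝒳 ≫ (e.hom ⊗ₘ e.hom) ≫ μ[E] ≫ e.inv).left ≫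
        pullback.fst 𝒳.hom (specGenericPoint R K))
    (ΦD : (D : Scheme.{u}) ⟶ (𝒳 ⊗ 𝒳).left) [IsDominant ΦD]
    (hΦ₁ : ΦD ≫ (fst 𝒳 𝒳).left = D.ι ≫ (fst 𝒳 𝒳).left) (hΦ₂ : ΦD ≫ (snd 𝒳 𝒳).left = m)
    (hiso : ∀ qD : ↥(D : Scheme.{u}),
      (𝒳 ⊗ 𝒳).hom.base (D.ι.base qD) ∈ Set.range (specGenericPoint R K).base → IsIso (ΦD.stalkMap qD))
    (σ : (𝒳 ⊗ 𝒳).left.functionField →+* (𝒳 ⊗ 𝒳).left.functionField)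
    (hσ : (functionFieldMap D.ι).comp σ = functionFieldMap ΦD)
    (f₀ : 𝒳.left.functionField) (y : Fin n → 𝒳.left.functionField)
    (B₀ : Module.Basis (Fin n) 𝒳.left.functionField Ω[𝒳.left.functionField⁄R])
    (hB₀ : ∀ i, B₀ i = KaehlerDifferential.D R _ (y i))
    (hθ : ∀ (p : 𝒳.left) (_ : 𝒳.hom.base p ∈ Set.range (specGenericPoint R K).base)
        (z : Fin n → 𝒳.left.presheaf.stalk p)
        (b : letI := (stalkHom 𝒳 p).toAlgebra
          Module.Basis (Fin n) (𝒳.left.presheaf.stalk p) Ω[𝒳.left.presheaf.stalk p⁄R])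
        (_ : letI := (stalkHom 𝒳 p).toAlgebra; ∀ i, b i = KaehlerDifferential.D R _ (z i))
        (B : Module.Basis (Fin n) 𝒳.left.functionField Ω[𝒳.left.functionField⁄R])
        (_ : ∀ i, B i = KaehlerDifferential.D R _ (toFunctionField p (z i))),
        IsUnitAt p (f₀ * B.det B₀))
    (B₂ : Module.Basis (Fin n) (𝒳 ⊗ 𝒳).left.functionField
        Ω[(𝒳 ⊗ 𝒳).left.functionField⁄𝒳.left.functionField])
    (hB₂ : ∀ i, B₂ i = KaehlerDifferential.D 𝒳.left.functionField _
        (functionFieldMap (snd 𝒳 𝒳).left (y i))) :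
    ∃ t : (𝒳 ⊗ 𝒳).left.presheaf.stalk
        ((pullback.lift ((η[E].left ≫ e.inv.left) ≫ pullback.fst 𝒳.hom (specGenericPoint R K))
          ((η[E].left ≫ e.inv.left) ≫ pullback.fst 𝒳.hom (specGenericPoint R K)) rfl :
            Spec (.of K) ⟶ (𝒳 ⊗ 𝒳).left).base (IsLocalRing.closedPoint K)),
      toFunctionField _ t =
        σ (functionFieldMap (snd 𝒳 𝒳).left f₀) *
          B₂.det (fun i => KaehlerDifferential.D 𝒳.left.functionField _
            (σ (functionFieldMap (snd 𝒳 𝒳).left (y i)))) *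
          (functionFieldMap (snd 𝒳 𝒳).left f₀)⁻¹ ∧
      IsLocalRing.residue _ t = 1 := by
  -- the unit slice `iT : 𝒳_K → D` (★ `exists_unitSlice_liftD`) and the `K`-point `w` of `𝒳_K` above `x`
  have hx : ((η[E].left ≫ e.inv.left) ≫ pullback.fst 𝒳.hom (specGenericPoint R K)) ≫ 𝒳.hom =
      specGenericPoint R K := unitPoint_comp_hom 𝒳 E e
  obtain ⟨iT, h1, -, h3⟩ := exists_unitSlice_liftD 𝒳 E e D hD m hgen ΦD hΦ₁ hΦ₂
  have hJ : iT ≫ D.ι ≫ (snd 𝒳 𝒳).left = pullback.fst 𝒳.hom (specGenericPoint R K) := by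
    rw [← Category.assoc, h1, Over.snd_left]
    exact pullback.lift_snd _ _ _
  have hconst : iT ≫ D.ι ≫ (fst 𝒳 𝒳).left = pullback.snd 𝒳.hom (specGenericPoint R K) ≫
      ((η[E].left ≫ e.inv.left) ≫ pullback.fst 𝒳.hom (specGenericPoint R K)) := by
    rw [← Category.assoc, h1, Over.fst_left]
    exact pullback.lift_fst _ _ _
  obtain ⟨sK, hsK₁, hsK₂⟩ : ∃ sK : Spec (.of K) ⟶ pullback 𝒳.hom (specGenericPoint R K),
      sK ≫ pullback.fst 𝒳.hom (specGenericPoint R K) =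
        (η[E].left ≫ e.inv.left) ≫ pullback.fst 𝒳.hom (specGenericPoint R K) ∧
      sK ≫ pullback.snd 𝒳.hom (specGenericPoint R K) = 𝟙 _ :=
    ⟨pullback.lift ((η[E].left ≫ e.inv.left) ≫ pullback.fst 𝒳.hom (specGenericPoint R K)) (𝟙 _)
      (by rw [Category.id_comp]; exact hx), pullback.lift_fst _ _ _, pullback.lift_snd _ _ _⟩
  obtain ⟨t, ht, h1t⟩ := exists_germ_shearCocycle_residue_eq_one K 𝒳 n hRK hLM D ΦD hΦ₁ hiso σ hσ f₀ y B₀ hB₀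
    hθ B₂ hB₂ (sK.base (IsLocalRing.closedPoint K)) iT (pullback.fst 𝒳.hom (specGenericPoint R K)) hJ
    (pullback.snd 𝒳.hom (specGenericPoint R K)) _ hx hconst h3
  -- the two names of the point `(ε, ε)`
  have hs : sK ≫ iT ≫ D.ι =
      pullback.lift ((η[E].left ≫ e.inv.left) ≫ pullback.fst 𝒳.hom (specGenericPoint R K))
        ((η[E].left ≫ e.inv.left) ≫ pullback.fst 𝒳.hom (specGenericPoint R K)) rfl := by
    rw [h1]
    apply pullback.hom_ext
    · rw [Category.assoc, pullback.lift_fst, pullback.lift_fst, ← Category.assoc, hsK₂, Category.id_comp]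
    · rw [Category.assoc, pullback.lift_snd, pullback.lift_snd, hsK₁]
  have hz : D.ι.base (iT.base (sK.base (IsLocalRing.closedPoint K))) =
      (pullback.lift ((η[E].left ≫ e.inv.left) ≫ pullback.fst 𝒳.hom (specGenericPoint R K))
        ((η[E].left ≫ e.inv.left) ≫ pullback.fst 𝒳.hom (specGenericPoint R K)) rfl :
          Spec (.of K) ⟶ (𝒳 ⊗ 𝒳).left).base (IsLocalRing.closedPoint K) :=
    congrArg (fun φ => φ.base (IsLocalRing.closedPoint K)) hs
  -- move the germ along the identity of points
  refine ⟨((𝒳 ⊗ 𝒳).left.presheaf.stalkCongr (.of_eq hz)).hom t, ?_, ?_⟩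
  · rw [← ht, TopCat.Presheaf.stalkCongr_hom]
    simp only [toFunctionField, RingHom.algebraMap_toAlgebra]
    rw [← CommRingCat.comp_apply, TopCat.Presheaf.stalkSpecializes_comp]
  · -- `t - 1` is not a unit, hence neither is its image under the ring isomorphism `stalkCongr`
    have hm : t - 1 ∈ maximalIdeal _ := by
      rw [← residue_eq_zero_iff, map_sub, h1t, map_one, sub_self]
    have hm' : ((𝒳 ⊗ 𝒳).left.presheaf.stalkCongr (.of_eq hz)).hom t - 1 ∈ maximalIdeal _ := by
      rw [mem_maximalIdeal, mem_nonunits_iff] at hm ⊢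
      intro hu
      apply hm
      have h2 := hu.map ((𝒳 ⊗ 𝒳).left.presheaf.stalkCongr (.of_eq hz)).inv.hom
      rw [map_sub, map_one, ← CommRingCat.comp_apply, Iso.hom_inv_id, CommRingCat.id_apply] at h2
      exact h2
    rw [← residue_eq_zero_iff, map_sub, map_one, sub_eq_zero] at hm'
    exact hm'

end UnitPoint

end Literature.AlgebraicGeometry.Motives

end
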